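import Literature.AlgebraicGeometry.CossartPiltant200819.GoodResolution2019
import HarnessLib

/-!
# Cossart–Piltant 2008 affine-model statements from the 2019 theorem (bookkeeping bridge)

V. Cossart, O. Piltant, *Resolution of singularities of threefolds in positive characteristic I*,
J. Algebra 320 (2008) 1051–1082 (HAL-00139124), Prop. 4.9 ("Refined patching theorem") and the
affine-model form of Thm. 2.1 (i)(ii), are vendored in `Threefolds2008.lean` as the named facts
`CP2008.RefinedPatching` and `CP2008.ResolutionOfAffineModels`: both conclude, for an affine
model `Spec A` (`A ⊆ K` finitely generated over `k`, `Frac A = K`, `trdeg_k K = 3`), the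
existence of a resolution which is an isomorphism over `Reg (Spec A)`; they differ only in their
(local-uniformization, resp. differential-finiteness) hypotheses. `Bridge2019.lean` listed
`RefinedPatching` among the facts "not derivable from the weak 2019 fact `CossartPiltant2019`"
(bare `HasResolution`, no isomorphism clause). It IS, however, a formal consequence of the
GENERAL vendored form `Resolution.CossartPiltant2019General` (Cossart–Piltant 2019, Thm. 1.1
(i)(ii): reduced separated Noetherian quasi-excellent schemes of dimension `≤ 3`), because an
affine model is reduced (a subring of a field), separated (affine), Noetherian and
quasi-excellent (finite type over a field, `Stacks07QW_field`) of dimension `≤ 3`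
(`Resolution.ringKrullDim_le_of_fg_of_trdeg_le`). This file records exactly that bookkeeping:

* `CP2008.exists_resolution_isIso_regularLocus_of_general` — the common conclusion for every
  affine model of a function field of transcendence degree `≤ 3` over ANY field;
* `CP2008.refinedPatching_of_general`, `CP2008.resolutionOfAffineModels_of_general` — the two
  named facts follow (their extra hypotheses are not used);
* `CP2019.CossartPiltant2019Thm11.refinedPatching`, `.resolutionOfAffineModels` — hence from the
  full Thm. 1.1 (`GoodResolution2019.lean`).

No new statements, no proof content of either paper. After this file the [CP-I]/[CP-II] named
facts of this directory NOT derived inside the tree from the 2019 theorem are exactly the finer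
valuation-theoretic ones — `CP2008.Cofinality` (4.6), `GaloisApproximation` (6.2 (1)),
`MonomialUniformization` (8.1), `DescentBelowInertiaField` (9.3) (`Ramification2008.lean`) — and
`CP2008.TowerExists2008` (`Tower2008.lean`). The bare local-uniformization statements
(`ReductionToArtinSchreier`, `ClimbToInertiaField`, `PrimeDegreeAscent`, `TamePrimeDescent`,
`DescentBelowRamificationField`, `LU3DiffFinite`, `RankReduction`, `CossartPiltant2009Main`) were
already derived in `Bridge2019.lean` (`cp2008_bareLU_of_cossartPiltant2019`,
`rankReduction_of_cossartPiltant2019LU3`), whose `resolutionOfAffineModels_of_cossartPiltant2019`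
takes `RefinedPatching` as a hypothesis — the hypothesis the present file discharges.
-/

open CategoryTheory AlgebraicGeometry TopologicalSpace

namespace Literature.AlgebraicGeometry.CossartPiltant200819.CP2008

open Literature.AlgebraicGeometry.Resolution

universe u

/-- Every affine model `Spec A` of a function field `K/k` of transcendence degree `≤ 3` over any
field `k` (`A ⊆ K` a finitely generated `k`-subalgebra with `Frac A = K`) has a resolution of
singularities which is an isomorphism over `Reg (Spec A)` — from Cossart–Piltant 2019 Thm. 1.1 in
the vendored form `CossartPiltant2019General` and `Stacks07QW_field` (finite type algebras over a
field are quasi-excellent). Bookkeeping: `A` is a domain hence reduced, `Spec A` is separated and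
Noetherian, `dim A ≤ trdeg_k K ≤ 3` (`ringKrullDim_le_of_fg_of_trdeg_le`).
[cite: CossartPiltant2019, Thm. 1.1; CossartPiltant2008, Prop 4.9 (HAL pp. 15–16)] -/
theorem exists_resolution_isIso_regularLocus_of_general (h : CossartPiltant2019General.{u})
    (h07 : Stacks07QW_field.{u}) {k K : Type u} [Field k] [Field K] [Algebra k K]
    (A : Subalgebra k K) (hfg : A.FG) (hfr : IsFractionRing A K) (hd : Algebra.trdeg k K ≤ 3) :
    ∃ (X' : Scheme.{u}) (π : X' ⟶ Spec (.of A)), IsResolution π ∧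
      ∃ U : (Spec (.of A)).Opens,
        (U : Set (Spec (.of A))) = Scheme.regularLocus (Spec (.of A)) ∧ IsIso (π ∣_ U) := by
  haveI := hfr
  have hft : Algebra.FiniteType k A := A.fg_iff_finiteType.mp hfg
  haveI : IsNoetherianRing A := Algebra.FiniteType.isNoetherianRing k A
  haveI : IsNoetherianRing (CommRingCat.of A) := ‹IsNoetherianRing A›
  haveI : _root_.IsReduced (CommRingCat.of A) := (inferInstance : _root_.IsReduced A)
  haveI : LocallyOfFiniteType (Spec.map (CommRingCat.ofHom (algebraMap k A))) := by
    rw [HasRingHomProperty.Spec_iff (P := @LocallyOfFiniteType)]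
    exact RingHom.finiteType_algebraMap.mpr hft
  have hqe : Scheme.IsQuasiExcellent (Spec (.of A)) :=
    Scheme.isQuasiExcellent_of_locallyOfFiniteType h07
      (Spec.map (CommRingCat.ofHom (algebraMap k A)))
  have hdim : ringKrullDim A ≤ 3 := by
    simpa using ringKrullDim_le_of_fg_of_trdeg_le A hfg (d := 3) (by exact_mod_cast hd)
  have hdim' : topologicalKrullDim (Spec (.of A)) ≤ 3 :=
    (le_of_eq (PrimeSpectrum.topologicalKrullDim_eq_ringKrullDim (R := A))).trans hdim
  exact h (Spec (.of A)) hqe hdim'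

/-- **Prop. 4.9 (Refined patching), affine rendering, from the 2019 theorem**: the named fact
`RefinedPatching` follows from `CossartPiltant2019General` and `Stacks07QW_field`; its local
uniformization hypothesis is not needed (the 2019 theorem is unconditional).
[cite: CossartPiltant2008, Prop 4.9 (HAL pp. 15–16); CossartPiltant2019, Thm. 1.1] -/
theorem refinedPatching_of_general (h : CossartPiltant2019General.{u})
    (h07 : Stacks07QW_field.{u}) : RefinedPatching.{u} := by
  intro k K _ _ _ _ h3 _ A hfg hfr
  exact exists_resolution_isIso_regularLocus_of_general h h07 A hfg hfr (by rw [h3])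

/-- **Thm. 2.1 (i)(ii) on affine models, from the 2019 theorem**: the named fact
`ResolutionOfAffineModels` follows from `CossartPiltant2019General` and `Stacks07QW_field`, for
every ground field (the characteristic and differential-finiteness hypotheses are not used).
[cite: CossartPiltant2008, Thm 2.1 (HAL p. 3); CossartPiltant2019, Thm. 1.1] -/
theorem resolutionOfAffineModels_of_general (h : CossartPiltant2019General.{u})
    (h07 : Stacks07QW_field.{u}) : ResolutionOfAffineModels.{u} := by
  intro p _ k _ _ _ K _ _ _ h3 A hfg hfr
  exact exists_resolution_isIso_regularLocus_of_general h h07 A hfg hfr (by rw [h3])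

end Literature.AlgebraicGeometry.CossartPiltant200819.CP2008

namespace Literature.AlgebraicGeometry.CossartPiltant200819.CP2019

open Literature.AlgebraicGeometry.Resolution

universe u

/-- Thm. 1.1 (full form) gives [CP-I] Prop. 4.9 in its affine rendering.
[cite: CossartPiltant2019, Thm. 1.1] -/
theorem CossartPiltant2019Thm11.refinedPatching (h : CossartPiltant2019Thm11.{u})
    (h07 : Stacks07QW_field.{u}) : CP2008.RefinedPatching.{u} :=
  CP2008.refinedPatching_of_general h.general h07

/-- Thm. 1.1 (full form) gives [CP-I] Thm. 2.1 (i)(ii) on affine models of function fields.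
[cite: CossartPiltant2019, Thm. 1.1] -/
theorem CossartPiltant2019Thm11.resolutionOfAffineModels (h : CossartPiltant2019Thm11.{u})
    (h07 : Stacks07QW_field.{u}) : CP2008.ResolutionOfAffineModels.{u} :=
  CP2008.resolutionOfAffineModels_of_general h.general h07

end Literature.AlgebraicGeometry.CossartPiltant200819.CP2019
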